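import Summits.Ventures.HodgeRepro.Tier4.Target

/-!
# Tier4/TargetApi.lean — small API over the FROZEN target (Tier-4 lead, 2026-08-28)

Companion of `Tier4/Target.lean` (frozen; `def P_T4` is never restated here). Two unfolding lemmas for the
vocabulary of `P_T4` that every line uses: the Hecke translate by a SINGLE element `γ` (terms `[(1, {γ})]`) is
the plain translate `a ∘ M(γ)`, and the Hecke translate by a single double coset with representatives `R` is
the sum over `R`. Nothing is asserted about `P_T4`. HC_CM is NOT proved by anyone in this repository.
-/

set_option autoImplicit false

noncomputable section

namespace Summit.Ventures.HodgeRepro.Tier4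

/-- The Hecke translate by the single element `γ` (coefficient `1`) is the plain translate `z ↦ a (M(γ) z)`. -/
theorem heckeTranslate_single {E : Type*} [Field E] {W : Type*} [AddCommGroup W]
    (τ₀ : E →+* ℂ) (C : Matrix (Fin 3) (Fin 3) ℂ) (γ : Matrix (Fin 3) (Fin 3) E)
    (a : (Fin 2 → ℂ) → W) :
    heckeTranslate τ₀ C ⟨[(1, {γ})]⟩ a = fun z => a (actM (toBallMat τ₀ C γ) z) := by
  funext z
  simp [heckeTranslate]

/-- The Hecke translate by one double coset (coefficient `1`, representatives `R`) is the sum over `R`. -/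
theorem heckeTranslate_coset {E : Type*} [Field E] {W : Type*} [AddCommGroup W]
    (τ₀ : E →+* ℂ) (C : Matrix (Fin 3) (Fin 3) ℂ) (R : Finset (Matrix (Fin 3) (Fin 3) E))
    (a : (Fin 2 → ℂ) → W) :
    heckeTranslate τ₀ C ⟨[(1, R)]⟩ a = fun z => R.sum (fun r => a (actM (toBallMat τ₀ C r) z)) := by
  funext z
  simp [heckeTranslate]

end Summit.Ventures.HodgeRepro.Tier4

end
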